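import Summits.Parity.GeneralizedHardyLittlewood.Theorems.LeeYangFibresCellParityLawDefs
import Summits.Parity.GeneralizedHardyLittlewood.Theorems.LeeYangFibresCellParityLawSingularRatio
import Summits.Parity.GeneralizedHardyLittlewood.Theorems.LeeYangFibresCellParityLawEulerRatio
import Summits.Parity.GeneralizedHardyLittlewood.Theorems.LeeYangFibresCellParityLawSieveDefs
import Summits.Parity.GeneralizedHardyLittlewood.Theorems.LeeYangFibresCellParityLawMertensAux
import Literature.NumberTheory.Sieve.SieveFunctions
import Literature.NumberTheory.Sieve.SieveFramework
import Literature.NumberTheory.Sieve.JurkatRichertRefutation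
import Literature.NumberTheory.Sieve.BrunGoldbach
import Literature.NumberTheory.LFunctions.MertensFormula
import HarnessLib

/-!
# Route `LeeYangFibres`, crux `CellParityLaw` (stmt-Parity-14109), line `section-annihilator`:
# the registered stub `stub_sectionMertens` — Mertens-side main-term control

We prove `SectionMertens` (vocabulary file `LeeYangFibresCellParityLawSieveDefs`, skeleton v9): for a
non-degenerate system `Ψ = (ψ₀, …, ψ_t)` of one-dimensional forms `ψ_k(n) = a_k n + b_k` of size
`‖Ψ‖_N ≤ L`, a coordinate `i` whose section density `g = sectionDensity Ψ i` has no degenerate prime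
(`g(p) < 1`) and whose sub-system `Ψ₋ᵢ = Fin.removeNth i Ψ` has `𝔖(Ψ₋ᵢ) ≠ 0`, and `N ≥ N₀(t, L, B_η)`:
(sharp) `e^γ V(z) ≤ (2/((1-η) log N)) · H · (1 + C/log N)` at `η = (log log N)^{-B_η}`,
`z = N^{(1-η)/2}`, `V(z) = ∏_{p<z} (1 - g(p))`, `H = H_{Ψ,i}` Bombieri's constant (`sectionH`);
(crude) `V(z) ≤ C (log log N)/log z` for `2 ≤ z ≤ N`. Here `C = 400(t+1) + e^{25/log 2}(3⁹ + 4e⁵(t+1))`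
and `N₀ = ⌈exp(4(L + 16t + 2) + 100)⌉ + 8 + L(2L²)^t`.

With `E_p = (1 - g(p))/(1 - 1/p)` and `Π(z) = ∏_{p<z} (1 - 1/p)⁻¹` (`PairProducts.mertensProd`) one has
`V(z) = (∏_{p<z} E_p) Π(z)⁻¹`; the Euler-factor lemmas are in the auxiliary file
`Theorems/LeeYangFibresCellParityLawMertensAux.lean` (`MertensAux.prod_one_sub_eq`, Mertens with rate
`MertensAux.inv_mertensProd_le`, the tail of Bombieri's constant `MertensAux.head_le`:
`∏_{p<m} E_p ≤ H (1 + 16t/m)` once every prime `p ≥ m` has `p > L`, `p ≥ 2t + 2` and `m ≥ 16t`, and the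
crude head bound `MertensAux.head_le_crossDisc`: `∏_{p<m} E_p ≤ Δ/φ(Δ)`,
`Δ = |a_i| ∏_{k ≠ i} |a_i b_k - a_k b_i|`).
* (sharp, `MertensAux.sharp_clause`) for `log N ≥ 4(L + 16t + 2) + 100`: `η ≤ 1/2`,
  `⌈z⌉ ≥ z ≥ N^{1/4} ≥ (log N)/4`, `log z = (1-η)(log N)/2 ≥ 25`, so
  `e^γ V(z) ≤ H (1 + 16t/⌈z⌉) e^{25/log z}/log z ≤ (2/((1-η) log N)) H (1 + 400(t+1)/log N)`
  (`e^u ≤ 1 + 2u` for `0 ≤ u ≤ 1`);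
* (crude, `MertensAux.crude_clause`) `V(z) ≤ (Δ/φ(Δ)) Π(z)⁻¹` with `Δ ≤ L(2L²N)^t ≤ 2N^{t+1}`, Landau's
  bound in the tree's form `BrunGoldbach.self_div_totient_le` (`Δ/φ(Δ) ≤ (3⁹ + 4e⁵(t+1)) log log N`,
  exactly as in `stub_singularRatio`) and `Π(z)⁻¹ ≤ e^{25/log 2}/log z`.

References: E. Bombieri, *The asymptotic sieve*, Rend. Accad. Naz. XL (5) 1/2 (1975/76) 243–269
[BombieriAsymptoticSieve1976]; G. H. Hardy, E. M. Wright, Thm 429 (Mertens), Thm 328 (Landau)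
[HardyWright2008]; B. Green, T. Tao, Ann. of Math. 171 (2010), Lemma 1.3 [GreenTao2010].
-/

noncomputable section

open scoped BigOperators Topology Classical
open Finset Filter Literature.NumberTheory.Sieve

namespace Summit.Parity.GeneralizedHardyLittlewood.Cruxes.CellParityLaw.SectionAnnihilator

namespace MertensAux

variable {t : ℕ}

/-! ## The two clauses -/

/-- **(sharp)** For `log N ≥ 4(L + 16t + 2) + 100`: `η ≤ 1/2`, `⌈z⌉ ≥ z ≥ N^{1/4} ≥ (log N)/4`,
`log z = (1-η)(log N)/2 ≥ 25`, and `e^γ V(z) = e^γ (∏_{p<z} E_p) Π(z)⁻¹ ≤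
H (1 + 16t/⌈z⌉) e^{25/log z}/log z ≤ (2/((1-η) log N)) · H · (1 + 400(t+1)/log N)`. -/
theorem sharp_clause {L N Bη : ℕ} (hB : 1 ≤ Bη) (hNpos : 0 < N)
    (hA : 4 * ((L : ℝ) + 16 * t + 2) + 100 ≤ Real.log N)
    (Ψ : Fin (t + 1) → AffLinForm 1) (hΨ : IsNondegenerateSystem Ψ) (hL : affLinSize Ψ N ≤ L)
    (i : Fin (t + 1)) (hg1 : ∀ p : ℕ, p.Prime → sectionDensity Ψ i p < 1)
    (hne : singularProduct (Fin.removeNth i Ψ) ≠ 0) :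
    Real.exp Real.eulerMascheroniConstant *
        ∏ p ∈ Nat.primesBelow ⌈(N : ℝ) ^ ((1 - 1 / Real.log (Real.log N) ^ Bη) / 2)⌉₊,
          (1 - sectionDensity Ψ i p) ≤
      2 / ((1 - 1 / Real.log (Real.log N) ^ Bη) * Real.log N) * sectionH Ψ i *
        (1 + 400 * ((t : ℝ) + 1) / Real.log N) := by
  have hNr : (0 : ℝ) < N := by exact_mod_cast hNpos
  have ht0 : (0 : ℝ) ≤ t := Nat.cast_nonneg t
  have hL0 : (0 : ℝ) ≤ L := Nat.cast_nonneg L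
  have hlogN : 100 ≤ Real.log N := by linarith
  have hlogpos : 0 < Real.log N := by linarith
  have hll2 : 2 ≤ Real.log (Real.log N) := by
    rw [Real.le_log_iff_exp_le hlogpos, show (2 : ℝ) = 1 + 1 by norm_num, Real.exp_add]
    nlinarith [Real.exp_one_lt_d9, Real.exp_pos 1]
  have hH0 : 0 ≤ sectionH Ψ i := sectionH_nonneg Ψ hΨ i hne
  set η : ℝ := 1 / Real.log (Real.log N) ^ Bη with hη
  have hη0 : 0 < η := by rw [hη]; positivity
  have hη2 : η ≤ 1 / 2 := by
    rw [hη]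
    exact one_div_le_one_div_of_le two_pos (hll2.trans (le_self_pow₀ (by linarith) (by omega)))
  have h1η : 0 < 1 - η := by linarith
  set z : ℝ := (N : ℝ) ^ ((1 - η) / 2) with hz
  have hlogz : Real.log z = (1 - η) / 2 * Real.log N := by rw [hz, Real.log_rpow hNr]
  have hlogz4 : Real.log N / 4 ≤ Real.log z := by rw [hlogz]; nlinarith
  have hlogzpos : 0 < Real.log z := by linarith
  have hinv : 1 / Real.log z = 2 / ((1 - η) * Real.log N) := by
    rw [hlogz, div_eq_div_iff (by positivity) (by positivity)]
    ring
  -- `⌈z⌉ ≥ z ≥ N^{1/4} ≥ (log N)/4`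
  have hz4 : Real.log N / 4 ≤ z := by
    have h1 := Real.log_le_rpow_div hNr.le (by norm_num : (0 : ℝ) < 1 / 4)
    rw [le_div_iff₀ (by norm_num : (0 : ℝ) < 1 / 4)] at h1
    have h2 : (N : ℝ) ^ ((1 : ℝ) / 4) ≤ z :=
      Real.rpow_le_rpow_of_exponent_le (by exact_mod_cast hNpos) (by linarith)
    linarith
  have hmz : z ≤ ⌈z⌉₊ := Nat.le_ceil z
  have hmL : L < ⌈z⌉₊ := by exact_mod_cast (show (L : ℝ) < ⌈z⌉₊ by linarith)
  have hmt : 2 * t + 2 ≤ ⌈z⌉₊ := by exact_mod_cast (show (2 * t + 2 : ℝ) ≤ ⌈z⌉₊ by linarith)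
  have hm16 : 16 * t ≤ ⌈z⌉₊ := by exact_mod_cast (show (16 * t : ℝ) ≤ ⌈z⌉₊ by linarith)
  -- the head of Bombieri's constant, Mertens with rate, `e^u ≤ 1 + 2u`
  have hhead := head_le Ψ hΨ hL i hg1 hne hmL hmt hm16
  have hMer := inv_mertensProd_le (show 2 ≤ z by linarith)
  have hV := prod_one_sub_eq Ψ i z
  set P : ℝ := ∏ p ∈ Nat.primesBelow ⌈z⌉₊, (1 - sectionDensity Ψ i p) / (1 - (p : ℝ)⁻¹) with hP
  have hP0 : 0 ≤ P := Finset.prod_nonneg fun p hp =>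
    eulerFactor_nonneg Ψ i (Nat.prime_of_mem_primesBelow hp) (hg1 _ (Nat.prime_of_mem_primesBelow hp))
  set u : ℝ := 25 / Real.log z with hu
  have hu0 : 0 ≤ u := by positivity
  have hu1 : u ≤ 1 := by rw [hu, div_le_one hlogzpos]; linarith
  have hexpu : Real.exp u ≤ 1 + 2 * u := by
    have h := Real.abs_exp_sub_one_le (x := u) (by rwa [abs_of_nonneg hu0])
    rw [abs_of_nonneg hu0] at h
    linarith [(abs_le.mp h).2]
  have hγ : Real.exp Real.eulerMascheroniConstant * Real.exp (-Real.eulerMascheroniConstant) = 1 := by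
    rw [← Real.exp_add, add_neg_cancel, Real.exp_zero]
  -- the two small factors: `16t/⌈z⌉ ≤ 64t/log N`, `2u ≤ 200/log N`, `2u ≤ 2`
  have ha : 16 * (t : ℝ) / ⌈z⌉₊ ≤ 64 * t / Real.log N := by
    calc 16 * (t : ℝ) / ⌈z⌉₊ ≤ 16 * (t : ℝ) / (Real.log N / 4) :=
          div_le_div_of_nonneg_left (by positivity) (by positivity) (hz4.trans hmz)
      _ = 64 * t / Real.log N := by field_simp; ring
  have hb : 2 * u ≤ 200 / Real.log N := by
    calc 2 * u ≤ 2 * (25 / (Real.log N / 4)) := by rw [hu]; gcongr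
      _ = 200 / Real.log N := by field_simp; ring
  have hab : (1 + 16 * (t : ℝ) / ⌈z⌉₊) * (1 + 2 * u) ≤ 1 + 400 * ((t : ℝ) + 1) / Real.log N := by
    have ha0 : 0 ≤ 16 * (t : ℝ) / ⌈z⌉₊ := by positivity
    have h3 : (1 + 16 * (t : ℝ) / ⌈z⌉₊) * (1 + 2 * u) ≤ 1 + 3 * (16 * (t : ℝ) / ⌈z⌉₊) + 2 * u := by
      nlinarith [mul_le_mul_of_nonneg_left (show 2 * u ≤ 2 by linarith) ha0]
    have h4 : 3 * (64 * (t : ℝ) / Real.log N) + 200 / Real.log N ≤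
        400 * ((t : ℝ) + 1) / Real.log N := by
      rw [show 3 * (64 * (t : ℝ) / Real.log N) + 200 / Real.log N =
          (192 * t + 200) / Real.log N by ring]
      exact div_le_div_of_nonneg_right (by nlinarith) hlogpos.le
    linarith
  calc Real.exp Real.eulerMascheroniConstant * ∏ p ∈ Nat.primesBelow ⌈z⌉₊, (1 - sectionDensity Ψ i p)
      ≤ Real.exp Real.eulerMascheroniConstant *
          (P * (Real.exp (-Real.eulerMascheroniConstant) * Real.exp u / Real.log z)) := by
        rw [hV]
        exact mul_le_mul_of_nonneg_left (mul_le_mul_of_nonneg_left hMer hP0) (Real.exp_pos _).le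
    _ = (Real.exp Real.eulerMascheroniConstant * Real.exp (-Real.eulerMascheroniConstant)) *
          (P * Real.exp u / Real.log z) := by ring
    _ ≤ sectionH Ψ i * (1 + 16 * t / ⌈z⌉₊) * (1 + 2 * u) / Real.log z := by
        rw [hγ, one_mul]
        exact div_le_div_of_nonneg_right
          (mul_le_mul hhead hexpu (Real.exp_pos u).le (mul_nonneg hH0 (by positivity))) hlogzpos.le
    _ = 2 / ((1 - η) * Real.log N) * sectionH Ψ i * ((1 + 16 * (t : ℝ) / ⌈z⌉₊) * (1 + 2 * u)) := by
        rw [div_eq_mul_one_div _ (Real.log z), hinv]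
        ring
    _ ≤ 2 / ((1 - η) * Real.log N) * sectionH Ψ i * (1 + 400 * ((t : ℝ) + 1) / Real.log N) :=
        mul_le_mul_of_nonneg_left hab
          (mul_nonneg (div_nonneg two_pos.le (mul_nonneg h1η.le hlogpos.le)) hH0)

/-- **(crude)** For `N ≥ 8`, `N ≥ L(2L²)^t`, `log N ≥ 1`, `log log N ≥ 1` and `z ≥ 2`:
`V(z) = (∏_{p<z} E_p) Π(z)⁻¹ ≤ (Δ/φ(Δ)) Π(z)⁻¹ ≤ (3⁹ + 4e⁵(t+1)) (log log N) · e^{25/log 2}/log z`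
(`Δ ≤ L(2L²N)^t ≤ 2N^{t+1}`, Landau's bound `BrunGoldbach.self_div_totient_le`, `e^{-γ} ≤ 1`). -/
theorem crude_clause {L N : ℕ} (hN8 : 8 ≤ N) (hNL : L * (2 * L ^ 2) ^ t ≤ N)
    (hlogN1 : 1 ≤ Real.log N) (hll1 : 1 ≤ Real.log (Real.log N))
    (Ψ : Fin (t + 1) → AffLinForm 1) (hΨ : IsNondegenerateSystem Ψ) (hL : affLinSize Ψ N ≤ L)
    (i : Fin (t + 1)) (hne : singularProduct (Fin.removeNth i Ψ) ≠ 0) {z : ℝ} (hz2 : 2 ≤ z) :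
    ∏ p ∈ Nat.primesBelow ⌈z⌉₊, (1 - sectionDensity Ψ i p) ≤
      Real.exp (25 / Real.log 2) * (3 ^ 9 + 4 * Real.exp 5 * ((t : ℝ) + 1)) *
        Real.log (Real.log N) / Real.log z := by
  have hNpos : 0 < N := by omega
  have ht0 : (0 : ℝ) ≤ t := Nat.cast_nonneg t
  have hlogz : 0 < Real.log z := Real.log_pos (by linarith)
  -- the integer `Δ` and the head
  have hΔ0 := SingularRatio.crossDisc_ne_zero Ψ hΨ i
  have hΔle := SingularRatio.crossDisc_le Ψ hNpos hL i
  set Δ : ℕ := ((Ψ i).coeff 0).natAbs * ∏ k : Fin t, ((Ψ i).coeff 0 * (Ψ (i.succAbove k)).const -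
      (Ψ (i.succAbove k)).coeff 0 * (Ψ i).const).natAbs with hΔdef
  have hhead : ∏ p ∈ Nat.primesBelow ⌈z⌉₊, (1 - sectionDensity Ψ i p) / (1 - (p : ℝ)⁻¹) ≤
      (Δ : ℝ) / Nat.totient Δ :=
    head_le_crossDisc Ψ hΨ i hne hΔ0 (Dvd.intro _ rfl)
      (fun k => (Finset.dvd_prod_of_mem _ (Finset.mem_univ k)).mul_left _) ⌈z⌉₊
  -- `Δ ≤ 2 N^{t+1}` and Landau's bound
  have hΔN : Δ ≤ 2 * N ^ (t + 1) := by
    calc Δ ≤ L * (2 * L ^ 2 * N) ^ t := hΔle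
      _ = L * (2 * L ^ 2) ^ t * N ^ t := by rw [mul_pow, mul_assoc]
      _ ≤ N * N ^ t := Nat.mul_le_mul_right _ hNL
      _ = N ^ (t + 1) := by rw [pow_succ, mul_comm]
      _ ≤ 2 * N ^ (t + 1) := by omega
  have hφ := BrunGoldbach.self_div_totient_le (Nat.one_le_iff_ne_zero.mpr hΔ0) hΔN
    (le_trans hN8 (Nat.le_self_pow (by omega) N))
  have hlp := SingularRatio.loglog_pow_le hlogN1 t
  have e5 := Real.exp_pos 5
  have hratio : (Δ : ℝ) / Nat.totient Δ ≤
      (3 ^ 9 + 4 * Real.exp 5 * ((t : ℝ) + 1)) * Real.log (Real.log N) := by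
    have h1 : 4 * Real.exp 5 * Real.log (Real.log (((N ^ (t + 1) : ℕ) : ℝ))) ≤
        4 * Real.exp 5 * (t + Real.log (Real.log N)) := mul_le_mul_of_nonneg_left hlp (by positivity)
    nlinarith [mul_nonneg (mul_nonneg e5.le ht0) (sub_nonneg.mpr hll1),
      mul_nonneg e5.le (sub_nonneg.mpr hll1)]
  -- Mertens, crudely
  have hγ0 : 0 ≤ Real.eulerMascheroniConstant :=
    le_trans (by norm_num) Real.one_half_lt_eulerMascheroniConstant.le
  have hMer : (PairProducts.mertensProd z)⁻¹ ≤ Real.exp (25 / Real.log 2) / Real.log z := by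
    refine (inv_mertensProd_le hz2).trans (div_le_div_of_nonneg_right ?_ hlogz.le)
    calc Real.exp (-Real.eulerMascheroniConstant) * Real.exp (25 / Real.log z)
        ≤ 1 * Real.exp (25 / Real.log 2) :=
          mul_le_mul (Real.exp_le_one_iff.mpr (by linarith)) (Real.exp_le_exp.mpr
            (div_le_div_of_nonneg_left (by norm_num) (Real.log_pos one_lt_two)
              (Real.log_le_log two_pos hz2))) (Real.exp_pos _).le zero_le_one
      _ = Real.exp (25 / Real.log 2) := one_mul _
  calc ∏ p ∈ Nat.primesBelow ⌈z⌉₊, (1 - sectionDensity Ψ i p)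
      ≤ (Δ : ℝ) / Nat.totient Δ * (PairProducts.mertensProd z)⁻¹ := by
        rw [prod_one_sub_eq Ψ i z]
        exact mul_le_mul_of_nonneg_right hhead (inv_pos.mpr (PairProducts.mertensProd_pos z)).le
    _ ≤ (3 ^ 9 + 4 * Real.exp 5 * ((t : ℝ) + 1)) * Real.log (Real.log N) *
          (Real.exp (25 / Real.log 2) / Real.log z) :=
        mul_le_mul hratio hMer (inv_pos.mpr (PairProducts.mertensProd_pos z)).le
          (mul_nonneg (by positivity) (by linarith))
    _ = Real.exp (25 / Real.log 2) * (3 ^ 9 + 4 * Real.exp 5 * ((t : ℝ) + 1)) *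
          Real.log (Real.log N) / Real.log z := by ring

end MertensAux

open MertensAux in
/-- **`stub_sectionMertens`** (registered stub of the line `section-annihilator`, skeleton v9): the
Mertens-side main-term control `SectionMertens`, with
`C = 400(t+1) + e^{25/log 2}(3⁹ + 4e⁵(t+1))` and `N₀ = ⌈exp(4(L + 16t + 2) + 100)⌉ + 8 + L(2L²)^t`
(`MertensAux.sharp_clause`, `MertensAux.crude_clause`). -/
theorem stub_sectionMertens : SectionMertens := by
  intro t L Bη hB
  refine ⟨400 * ((t : ℝ) + 1) + Real.exp (25 / Real.log 2) * (3 ^ 9 + 4 * Real.exp 5 * ((t : ℝ) + 1)),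
    ⌈Real.exp (4 * ((L : ℝ) + 16 * t + 2) + 100)⌉₊ + 8 + L * (2 * L ^ 2) ^ t,
    fun N hN Ψ hΨ hL i hg1 hne => ?_⟩
  -- unpacking `N ≥ N₀`
  have hN8 : 8 ≤ N := le_trans (by omega) hN
  have hNe : ⌈Real.exp (4 * ((L : ℝ) + 16 * t + 2) + 100)⌉₊ ≤ N := le_trans (by omega) hN
  have hNL : L * (2 * L ^ 2) ^ t ≤ N := le_trans (by omega) hN
  have hNpos : 0 < N := by omega
  have ht0 : (0 : ℝ) ≤ t := Nat.cast_nonneg t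
  have hL0 : (0 : ℝ) ≤ L := Nat.cast_nonneg L
  have hA : 4 * ((L : ℝ) + 16 * t + 2) + 100 ≤ Real.log N :=
    (Real.le_log_iff_exp_le (by exact_mod_cast hNpos)).mpr (Nat.ceil_le.mp hNe)
  have hlogpos : 0 < Real.log N := by linarith
  have hll1 : 1 ≤ Real.log (Real.log N) := by
    rw [Real.le_log_iff_exp_le hlogpos]
    linarith [Real.exp_one_lt_d9]
  have hH0 : 0 ≤ sectionH Ψ i := sectionH_nonneg Ψ hΨ i hne
  have hCt : (0 : ℝ) ≤ Real.exp (25 / Real.log 2) * (3 ^ 9 + 4 * Real.exp 5 * ((t : ℝ) + 1)) := by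
    positivity
  refine ⟨(sharp_clause hB hNpos hA Ψ hΨ hL i hg1 hne).trans ?_, fun z hz2 _ => ?_⟩
  · -- `1 + 400(t+1)/log N ≤ 1 + C/log N`
    have hpow1 : 1 ≤ Real.log (Real.log N) ^ Bη := one_le_pow₀ hll1
    have hη1 : 0 ≤ 1 - 1 / Real.log (Real.log N) ^ Bη :=
      sub_nonneg.mpr ((div_le_one (lt_of_lt_of_le one_pos hpow1)).mpr hpow1)
    refine mul_le_mul_of_nonneg_left ?_
      (mul_nonneg (div_nonneg two_pos.le (mul_nonneg hη1 hlogpos.le)) hH0)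
    have h := div_le_div_of_nonneg_right
      (show 400 * ((t : ℝ) + 1) ≤ 400 * ((t : ℝ) + 1) +
        Real.exp (25 / Real.log 2) * (3 ^ 9 + 4 * Real.exp 5 * ((t : ℝ) + 1)) by linarith)
      hlogpos.le
    linarith
  · -- `K ≤ C` in front of `(log log N)/log z`
    refine (crude_clause hN8 hNL (by linarith) hll1 Ψ hΨ hL i hne hz2).trans ?_
    refine div_le_div_of_nonneg_right (mul_le_mul_of_nonneg_right ?_ (by linarith))
      (Real.log_pos (by linarith)).le
    nlinarith

end Summit.Parity.GeneralizedHardyLittlewood.Cruxes.CellParityLaw.SectionAnnihilator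

end
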